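import Summits.Ventures.CertifiedManyBodySolver.Rows.TorusCeilingTTPrimeHom
import Summits.Ventures.CertifiedManyBodySolver.Rows.TorusCeilingCRTRect
import Literature.MathematicalPhysics.QuantumLattice.SiteBijectionSectorTransport
import Literature.MathematicalPhysics.QuantumLattice.HubbardNNNHopping
import HarnessLib

/-!
# Torus ceiling VII(e) — the CRT `t–t'` rings ARE the rectangular `t–t'` tori `3 × 4`, `3 × 5`
# (kernel rows, every sector)

HONEST FRAMING: first certified bounds; not a superconductivity verdict; every number certified or
labelled float. Part VI (`TorusCeilingCRTRect`) carried the Cayley graphs of `crtHom34|43` (`ℤ/12`, hops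
`{±4, ±9}`) and `crtHom35|53` (`ℤ/15`, hops `{±10, ±6}`) onto the tree's `fermionRectTorusGraph 3 4` / `3 5`
along the CRT site bijections `crtEquiv34 : k ↦ (k mod 3, k mod 4)`, `crtEquiv35`. Here the same bijections
carry the DIAGONAL Cayley graphs `homTorusGraph (crtHomXY.comp diagMap)` (`ℤ/12`: hops `{±1, ±5}`; `ℤ/15`:
`{±1, ±4}`) onto `fermionRectTorusDiagGraph 3 4` / `3 5` (`(x,y) ∼ (x±1, y±1)`; all `144` / `225` pairs by
`decide`), so `Γ (homHubbardTT' crtHom34 t t' U) Γ⁻¹ = hubbardRectTorusTT' 3 4 t t' U` (Literature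
`HubbardNNNHopping`, LeBlanc et al. 2015 eq. (1)) by `relabel_hamiltonian` (likewise `43`, `35`, `53`), and
sector energies agree (`minEnergyOn_relabel_szSector`). Hence the KERNEL ROWS
`rect34TT'_minEnergyOn_upDownSector_div_ge_of_window_certificate[_transposed]` (resp. `rect35TT'_…`): a
`t–t'` window certificate (data of the tree's `groundEnergy_hubbardTorusTT'_div_ge_of_window_certificate`)
whose window has coordinate spreads `≤ (2, 3)` or `(3, 2)` (resp. `(2, 4)` or `(4, 2)`) bounds EVERY sector
`(N↑, N↓) = (a, b)` of the rectangular `t–t'` torus itself (via Part VII(d)'s transport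
`homTorusTT'_minEnergyOn_upDownSector_div_ge_of_window_certificate_avg`):
`c − Σ‖aₖ‖ + (Σ_σ μ_σ)((a+b)/2/12 − ν) ≤ minEnergyOn (hubbardRectTorusTT' 3 4 t t' U) (szSector (a+b) ((a−b)/2)) / 12`
(resp. `3 5`, `/15`). USE (cal-3 `report/kernel_caps.py` v10, item K7b): the object bounded is the
Literature's rectangular `t–t'` torus, the model of the `3 × 4` / `3 × 5` `t' = −1/4` ED rows (those are ED
references, certified or labelled float, not part of this file).

References: [cite: Han2020Bootstrap, §3] [cite: KullEtAl2024, §5.3] [cite: LeBlancEtAl2015, eq. (1)]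
[cite: EsslerEtAl2005, §2.2.1 eqs. (2.32)–(2.39)]
-/

noncomputable section

open Matrix Finset
open Literature.MathematicalPhysics.QuantumLattice
open Literature.MathematicalPhysics.QuantumFieldTheory hiding Site
open Literature.MathematicalPhysics.QuantumManyBody.StateRelaxation
open Literature.Probability.LatticeModels
open HubbardWave0
open scoped ComplexOrder ComplexConjugate

namespace Summit.Ventures.CertifiedManyBodySolver.Rows

section Rect34

/-! ### `ℤ/12` with `t`-hops `{±4, ∓3}` and `t'`-hops `{±1, ∓5}` IS the `3 × 4` `t–t'` torus -/

/-- The adjacency check behind `fermionRectTorusDiagGraph_adj_crtEquiv34_crtHom34`: on residues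
`k, k' ∈ ℤ/12`, "`(k mod 3, k mod 4)` and `(k' mod 3, k' mod 4)` are DIAGONAL neighbours of the `3 × 4`
torus" iff "`k' − k ∈ {±1, ∓5} = {±13, ∓5} mod 12`" (all `144` pairs, by `decide`). [folklore] -/
theorem crt34Diag_adj_iff : ∀ k k' : Fin 12,
    (fermionRectTorusDiagGraph 3 4).Adj (toLex (crt34Pair k)) (toLex (crt34Pair k')) ↔
      (((k : ℕ) : ZMod 12) ≠ ((k' : ℕ) : ZMod 12) ∧ ∃ i : Fin 2,
        ((k' : ℕ) : ZMod 12) = ((k : ℕ) : ZMod 12) + ((![13, -5] i : ℤ) : ZMod 12) ∨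
          ((k : ℕ) : ZMod 12) = ((k' : ℕ) : ZMod 12) + ((![13, -5] i : ℤ) : ZMod 12)) := by
  decide

/-- **The diagonal CRT graph is the diagonal graph of the `3 × 4` torus**: `crtEquiv34` carries the
Cayley graph of `ℤ/12` generated by `crtHom34 ∘ D` (signed hops `{±1, ∓5} = {±13, ∓5} mod 12`) onto
`fermionRectTorusDiagGraph 3 4`. [folklore] -/
theorem fermionRectTorusDiagGraph_adj_crtEquiv34_crtHom34 (x y : FermionTorus 1 12) :
    (fermionRectTorusDiagGraph 3 4).Adj (crtEquiv34 x) (crtEquiv34 y) ↔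
      (homTorusGraph (crtHom34.comp diagMap)).Adj x y := by
  rw [crtHom34_comp_diagMap, homTorusGraph_adj, homSiteGraph_adj_iff,
    show crtEquiv34 x = toLex (crt34Pair (ofLex x 0)) from rfl,
    show crtEquiv34 y = toLex (crt34Pair (ofLex y 0)) from rfl, crt34Diag_adj_iff]
  have hts : ∀ u : FermionTorus 1 12, u.toTorusSite = fun _ => ((ofLex u 0 : ℕ) : ZMod 12) :=
    fun u => funext fun j => by rw [Subsingleton.elim j 0]; rfl
  have hc : ∀ i : Fin 2, ringHom 12 ![13, -5] (unitVec i) = fun _ => ((![13, -5] i : ℤ) : ZMod 12) :=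
    fun i => ringHom_unitVec 12 ![13, -5] i
  simp only [hts, hc, ne_eq, funext_iff, Fin.forall_fin_one, Pi.add_apply]

/-- **The CRT `t–t'` ring is the rectangular `t–t'` torus**:
`Γ (homHubbardTT' crtHom34 t t' U) Γ⁻¹ = hubbardRectTorusTT' 3 4 t t' U` along `crtEquiv34` (both hopping
graphs are carried, `relabel_hamiltonian`). [cite: EsslerEtAl2005, §2.2.1 eqs. (2.32)–(2.39)] -/
theorem relabel_crtEquiv34_homHubbardTT'_crtHom34 (t t' U : ℝ) :
    relabel (Orb.mapEquiv crtEquiv34) (homHubbardTT' crtHom34 t t' U) = hubbardRectTorusTT' 3 4 t t' U := by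
  rw [homHubbardTT', homHubbard, homHubbard, relabel_add,
    relabel_hamiltonian (homTorusGraph crtHom34) (fermionRectTorusGraph 3 4) crtEquiv34
      fermionRectTorusGraph_adj_crtEquiv34 t U,
    relabel_hamiltonian (homTorusGraph (crtHom34.comp diagMap)) (fermionRectTorusDiagGraph 3 4) crtEquiv34
      fermionRectTorusDiagGraph_adj_crtEquiv34_crtHom34 t' 0, hubbardRectTorusTT']

/-- **Sector energies of the rectangular `3 × 4` `t–t'` torus = those of the CRT ring `crtHom34`**, in
every joint sector `(N, S^z = M)` (`minEnergyOn_relabel_szSector`).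
[cite: BratteliRobinsonII1997, §5.2.2, Thm. 5.2.5] -/
theorem minEnergyOn_hubbardRectTorusTT'_szSector_eq_crtHom34 (t t' U : ℝ) (Ne : ℕ) (M : ℝ) :
    (hubbardRectTorusTT' 3 4 t t' U).minEnergyOn (szSector Ne M) =
      (homHubbardTT' crtHom34 t t' U).minEnergyOn (szSector Ne M) := by
  rw [← relabel_crtEquiv34_homHubbardTT'_crtHom34, minEnergyOn_relabel_szSector]

/-- The adjacency check behind `fermionRectTorusDiagGraph_adj_crtEquiv34_crtHom43`: on residues
`k, k' ∈ ℤ/12`, "`(k mod 3, k mod 4)` and `(k' mod 3, k' mod 4)` are DIAGONAL neighbours of the `3 × 4`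
torus" iff "`k' − k ∈ {±1, ±5} = {±13, ±5} mod 12`" (all `144` pairs, by `decide`). [folklore] -/
theorem crt43Diag_adj_iff : ∀ k k' : Fin 12,
    (fermionRectTorusDiagGraph 3 4).Adj (toLex (crt34Pair k)) (toLex (crt34Pair k')) ↔
      (((k : ℕ) : ZMod 12) ≠ ((k' : ℕ) : ZMod 12) ∧ ∃ i : Fin 2,
        ((k' : ℕ) : ZMod 12) = ((k : ℕ) : ZMod 12) + ((![13, 5] i : ℤ) : ZMod 12) ∨
          ((k : ℕ) : ZMod 12) = ((k' : ℕ) : ZMod 12) + ((![13, 5] i : ℤ) : ZMod 12)) := by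
  decide

/-- **The diagonal CRT graph is the diagonal graph of the `3 × 4` torus**: `crtEquiv34` carries the
Cayley graph of `ℤ/12` generated by `crtHom43 ∘ D` (signed hops `{±1, ±5} = {±13, ±5} mod 12`) onto
`fermionRectTorusDiagGraph 3 4`. [folklore] -/
theorem fermionRectTorusDiagGraph_adj_crtEquiv34_crtHom43 (x y : FermionTorus 1 12) :
    (fermionRectTorusDiagGraph 3 4).Adj (crtEquiv34 x) (crtEquiv34 y) ↔
      (homTorusGraph (crtHom43.comp diagMap)).Adj x y := by
  rw [crtHom43_comp_diagMap, homTorusGraph_adj, homSiteGraph_adj_iff,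
    show crtEquiv34 x = toLex (crt34Pair (ofLex x 0)) from rfl,
    show crtEquiv34 y = toLex (crt34Pair (ofLex y 0)) from rfl, crt43Diag_adj_iff]
  have hts : ∀ u : FermionTorus 1 12, u.toTorusSite = fun _ => ((ofLex u 0 : ℕ) : ZMod 12) :=
    fun u => funext fun j => by rw [Subsingleton.elim j 0]; rfl
  have hc : ∀ i : Fin 2, ringHom 12 ![13, 5] (unitVec i) = fun _ => ((![13, 5] i : ℤ) : ZMod 12) :=
    fun i => ringHom_unitVec 12 ![13, 5] i
  simp only [hts, hc, ne_eq, funext_iff, Fin.forall_fin_one, Pi.add_apply]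

/-- **The CRT `t–t'` ring is the rectangular `t–t'` torus**:
`Γ (homHubbardTT' crtHom43 t t' U) Γ⁻¹ = hubbardRectTorusTT' 3 4 t t' U` along `crtEquiv34` (both hopping
graphs are carried, `relabel_hamiltonian`). [cite: EsslerEtAl2005, §2.2.1 eqs. (2.32)–(2.39)] -/
theorem relabel_crtEquiv34_homHubbardTT'_crtHom43 (t t' U : ℝ) :
    relabel (Orb.mapEquiv crtEquiv34) (homHubbardTT' crtHom43 t t' U) = hubbardRectTorusTT' 3 4 t t' U := by
  rw [homHubbardTT', homHubbard, homHubbard, relabel_add,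
    relabel_hamiltonian (homTorusGraph crtHom43) (fermionRectTorusGraph 3 4) crtEquiv34
      fermionRectTorusGraph_adj_crtEquiv34_crtHom43 t U,
    relabel_hamiltonian (homTorusGraph (crtHom43.comp diagMap)) (fermionRectTorusDiagGraph 3 4) crtEquiv34
      fermionRectTorusDiagGraph_adj_crtEquiv34_crtHom43 t' 0, hubbardRectTorusTT']

/-- **Sector energies of the rectangular `3 × 4` `t–t'` torus = those of the CRT ring `crtHom43`**, in
every joint sector `(N, S^z = M)` (`minEnergyOn_relabel_szSector`).
[cite: BratteliRobinsonII1997, §5.2.2, Thm. 5.2.5] -/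
theorem minEnergyOn_hubbardRectTorusTT'_szSector_eq_crtHom43 (t t' U : ℝ) (Ne : ℕ) (M : ℝ) :
    (hubbardRectTorusTT' 3 4 t t' U).minEnergyOn (szSector Ne M) =
      (homHubbardTT' crtHom43 t t' U).minEnergyOn (szSector Ne M) := by
  rw [← relabel_crtEquiv34_homHubbardTT'_crtHom43, minEnergyOn_relabel_szSector]

/-- **`t–t'` window certificate ⇒ EVERY sector of the rectangular `3 × 4` PP `t–t'` torus (kernel row).**
With the data of the tree's `groundEnergy_hubbardTorusTT'_div_ge_of_window_certificate` (`t–t'` window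
certificate; window of coordinate spreads `≤ 2`, `≤ 3`, `Λ' ⊇ thicken Λ 1`), for every `a, b ≤ 12`:
`c − Σ‖aₖ‖ + (Σ_σ μ_σ)((a+b)/2/12 − ν) ≤ minEnergyOn (hubbardRectTorusTT' 3 4 t t' U) (szSector (a+b) ((a−b)/2)) / 12`.
This is the kernel form of the CAL ceiling page's "PP `3 × 4` `t' ≠ 0` torus rows".
[cite: Han2020Bootstrap, §3] [cite: LeBlancEtAl2015, eq. (1)] -/
theorem rect34TT'_minEnergyOn_upDownSector_div_ge_of_window_certificate (t t' U : ℝ) {nu nd : ℕ}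
    (hnu : nu ≤ Fintype.card (FermionTorus 1 12)) (hnd : nd ≤ Fintype.card (FermionTorus 1 12))
    {Λ Λ' : Finset (Site 2)} (hΛ : Λ ⊆ Λ')
    (hspread : ∀ x ∈ Λ', ∀ y ∈ Λ', |x 0 - y 0| ≤ (2 : ℤ) ∧ |x 1 - y 1| ≤ (3 : ℤ))
    (h8 : thicken Λ 1 ⊆ Λ') (h0 : thicken ({0} : Finset (Site 2)) 1 ⊆ Λ') (hz : (0 : Site 2) ∈ Λ')
    (μ : Fin 2 → ℝ) (ν : ℝ)
    {m : Type*} [Fintype m] [DecidableEq m] {Λm : Matrix m m ℂ} (hΛm : Λm.PosSemidef)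
    (O : m → FermionOp Λ')
    {κ : Type*} (s : Finset κ) (B : κ → FermionOp Λ)
    {ι : Type*} (tt : Finset ι) (v : ι → Site 2) (hsh : ∀ l, shiftSet (v l) Λ ⊆ Λ') (Y : ι → FermionOp Λ)
    {γ : Type*} (u : Finset γ) (b : γ → ℂ) (cw : γ → List (Orb (PolySite Λ') × Bool))
    (hcw : ∀ j ∈ u, ladderCharge (cw j) ≠ 0 ∨ ladderSpinCharge (cw j) ≠ 0)
    {δ : Type*} (ah : Finset δ) (dc : δ → ℝ) (V : δ → FermionOp Λ')
    {κ'' : Type*} (w : Finset κ'') (a : κ'' → ℂ) (word : κ'' → List (Orb (PolySite Λ') × Bool)) {c : ℝ}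
    (hcert : fermionEmbed (PolySite.incl h0) ((hubbardTTPrimeFermionInteraction t t' U).meanEnergyObs 1) -
        (c : ℂ) • (1 : FermionOp Λ') -
        ∑ σ : Fin 2, ((μ σ : ℝ) : ℂ) • (nAt 0 hz σ - ((ν : ℝ) : ℂ) • (1 : FermionOp Λ')) =
      gramForm Λm O +
        (∑ k ∈ s, ((hubbardTTPrimeFermionInteraction t t' U).localHamiltonian Λ' * fermionEmbed (PolySite.incl hΛ) (B k) -
            fermionEmbed (PolySite.incl hΛ) (B k) * (hubbardTTPrimeFermionInteraction t t' U).localHamiltonian Λ') +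
          ∑ l ∈ tt, (fermionEmbed (PolySite.incl (hsh l)) (fermionEmbed (PolySite.shiftEmb (v l) Λ) (Y l)) -
            fermionEmbed (PolySite.incl hΛ) (Y l)) +
          ∑ j ∈ u, b j • ladderWord (cw j)) +
        (∑ m' ∈ ah, ((dc m' : ℝ) : ℂ) • ((V m')ᴴ - V m') + ∑ k ∈ w, a k • ladderWord (word k))) :
    c - ∑ k ∈ w, ‖a k‖ + (∑ σ : Fin 2, μ σ) * (((nu : ℝ) + nd) / 2 / 12 - ν) ≤
      (hubbardRectTorusTT' 3 4 t t' U).minEnergyOn (szSector (nu + nd) (((nu : ℝ) - nd) / 2)) / 12 := by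
  have hInj' : Set.InjOn crtHom34 ↑Λ' := injOn_ringHom_two_of_spread 12 ![4, 9] (M₀ := 2) (M₁ := 3)
    (fun _ _ _ _ _ _ h₅ => by simp only [Matrix.cons_val_zero, Matrix.cons_val_one] at h₅; omega) hspread
  have hd : Function.Injective (signedHop crtHom34) := injective_signedHop_ringHom 12 ![4, 9] (by decide)
  have hd' : Function.Injective (signedHop (crtHom34.comp diagMap)) := by
    rw [crtHom34_comp_diagMap]; exact injective_signedHop_ringHom 12 ![13, -5] (by decide)
  have h := homTorusTT'_minEnergyOn_upDownSector_div_ge_of_window_certificate_avg crtHom34 t t' U hd hd' hnu hnd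
    hΛ h8 h0 hz hInj' μ ν hΛm O s B tt v hsh Y u b cw hcw ah dc V w a word hcert
  simp only [Nat.cast_ofNat, pow_one] at h
  rwa [minEnergyOn_hubbardRectTorusTT'_szSector_eq_crtHom34]

/-- **The same `3 × 4` `t–t'` row for windows drawn in a `4 × 3` box** (coordinate spreads `≤ 3`, `≤ 2`;
transposed generators `crtHom43`, the same rectangular torus `hubbardRectTorusTT' 3 4`).
[cite: Han2020Bootstrap, §3] [cite: LeBlancEtAl2015, eq. (1)] -/
theorem rect34TT'_minEnergyOn_upDownSector_div_ge_of_window_certificate_transposed (t t' U : ℝ) {nu nd : ℕ}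
    (hnu : nu ≤ Fintype.card (FermionTorus 1 12)) (hnd : nd ≤ Fintype.card (FermionTorus 1 12))
    {Λ Λ' : Finset (Site 2)} (hΛ : Λ ⊆ Λ')
    (hspread : ∀ x ∈ Λ', ∀ y ∈ Λ', |x 0 - y 0| ≤ (3 : ℤ) ∧ |x 1 - y 1| ≤ (2 : ℤ))
    (h8 : thicken Λ 1 ⊆ Λ') (h0 : thicken ({0} : Finset (Site 2)) 1 ⊆ Λ') (hz : (0 : Site 2) ∈ Λ')
    (μ : Fin 2 → ℝ) (ν : ℝ)
    {m : Type*} [Fintype m] [DecidableEq m] {Λm : Matrix m m ℂ} (hΛm : Λm.PosSemidef)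
    (O : m → FermionOp Λ')
    {κ : Type*} (s : Finset κ) (B : κ → FermionOp Λ)
    {ι : Type*} (tt : Finset ι) (v : ι → Site 2) (hsh : ∀ l, shiftSet (v l) Λ ⊆ Λ') (Y : ι → FermionOp Λ)
    {γ : Type*} (u : Finset γ) (b : γ → ℂ) (cw : γ → List (Orb (PolySite Λ') × Bool))
    (hcw : ∀ j ∈ u, ladderCharge (cw j) ≠ 0 ∨ ladderSpinCharge (cw j) ≠ 0)
    {δ : Type*} (ah : Finset δ) (dc : δ → ℝ) (V : δ → FermionOp Λ')
    {κ'' : Type*} (w : Finset κ'') (a : κ'' → ℂ) (word : κ'' → List (Orb (PolySite Λ') × Bool)) {c : ℝ}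
    (hcert : fermionEmbed (PolySite.incl h0) ((hubbardTTPrimeFermionInteraction t t' U).meanEnergyObs 1) -
        (c : ℂ) • (1 : FermionOp Λ') -
        ∑ σ : Fin 2, ((μ σ : ℝ) : ℂ) • (nAt 0 hz σ - ((ν : ℝ) : ℂ) • (1 : FermionOp Λ')) =
      gramForm Λm O +
        (∑ k ∈ s, ((hubbardTTPrimeFermionInteraction t t' U).localHamiltonian Λ' * fermionEmbed (PolySite.incl hΛ) (B k) -
            fermionEmbed (PolySite.incl hΛ) (B k) * (hubbardTTPrimeFermionInteraction t t' U).localHamiltonian Λ') +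
          ∑ l ∈ tt, (fermionEmbed (PolySite.incl (hsh l)) (fermionEmbed (PolySite.shiftEmb (v l) Λ) (Y l)) -
            fermionEmbed (PolySite.incl hΛ) (Y l)) +
          ∑ j ∈ u, b j • ladderWord (cw j)) +
        (∑ m' ∈ ah, ((dc m' : ℝ) : ℂ) • ((V m')ᴴ - V m') + ∑ k ∈ w, a k • ladderWord (word k))) :
    c - ∑ k ∈ w, ‖a k‖ + (∑ σ : Fin 2, μ σ) * (((nu : ℝ) + nd) / 2 / 12 - ν) ≤
      (hubbardRectTorusTT' 3 4 t t' U).minEnergyOn (szSector (nu + nd) (((nu : ℝ) - nd) / 2)) / 12 := by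
  have hInj' : Set.InjOn crtHom43 ↑Λ' := injOn_ringHom_two_of_spread 12 ![9, 4] (M₀ := 3) (M₁ := 2)
    (fun _ _ _ _ _ _ h₅ => by simp only [Matrix.cons_val_zero, Matrix.cons_val_one] at h₅; omega) hspread
  have hd : Function.Injective (signedHop crtHom43) := injective_signedHop_ringHom 12 ![9, 4] (by decide)
  have hd' : Function.Injective (signedHop (crtHom43.comp diagMap)) := by
    rw [crtHom43_comp_diagMap]; exact injective_signedHop_ringHom 12 ![13, 5] (by decide)
  have h := homTorusTT'_minEnergyOn_upDownSector_div_ge_of_window_certificate_avg crtHom43 t t' U hd hd' hnu hnd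
    hΛ h8 h0 hz hInj' μ ν hΛm O s B tt v hsh Y u b cw hcw ah dc V w a word hcert
  simp only [Nat.cast_ofNat, pow_one] at h
  rwa [minEnergyOn_hubbardRectTorusTT'_szSector_eq_crtHom43]

end Rect34

section Rect35

/-! ### `ℤ/15` with `t`-hops `{∓5, ±6}` and `t'`-hops `{±1, ±4}` IS the `3 × 5` `t–t'` torus -/

/-- The adjacency check behind `fermionRectTorusDiagGraph_adj_crtEquiv35_crtHom35`: on residues
`k, k' ∈ ℤ/15`, "`(k mod 3, k mod 5)` and `(k' mod 3, k' mod 5)` are DIAGONAL neighbours of the `3 × 5`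
torus" iff "`k' − k ∈ {±1, ±4} = {±16, ±4} mod 15`" (all `225` pairs, by `decide`). [folklore] -/
theorem crt35Diag_adj_iff : ∀ k k' : Fin 15,
    (fermionRectTorusDiagGraph 3 5).Adj (toLex (crt35Pair k)) (toLex (crt35Pair k')) ↔
      (((k : ℕ) : ZMod 15) ≠ ((k' : ℕ) : ZMod 15) ∧ ∃ i : Fin 2,
        ((k' : ℕ) : ZMod 15) = ((k : ℕ) : ZMod 15) + ((![16, 4] i : ℤ) : ZMod 15) ∨
          ((k : ℕ) : ZMod 15) = ((k' : ℕ) : ZMod 15) + ((![16, 4] i : ℤ) : ZMod 15)) := by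
  decide

/-- **The diagonal CRT graph is the diagonal graph of the `3 × 5` torus**: `crtEquiv35` carries the
Cayley graph of `ℤ/15` generated by `crtHom35 ∘ D` (signed hops `{±1, ±4} = {±16, ±4} mod 15`) onto
`fermionRectTorusDiagGraph 3 5`. [folklore] -/
theorem fermionRectTorusDiagGraph_adj_crtEquiv35_crtHom35 (x y : FermionTorus 1 15) :
    (fermionRectTorusDiagGraph 3 5).Adj (crtEquiv35 x) (crtEquiv35 y) ↔
      (homTorusGraph (crtHom35.comp diagMap)).Adj x y := by
  rw [crtHom35_comp_diagMap, homTorusGraph_adj, homSiteGraph_adj_iff,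
    show crtEquiv35 x = toLex (crt35Pair (ofLex x 0)) from rfl,
    show crtEquiv35 y = toLex (crt35Pair (ofLex y 0)) from rfl, crt35Diag_adj_iff]
  have hts : ∀ u : FermionTorus 1 15, u.toTorusSite = fun _ => ((ofLex u 0 : ℕ) : ZMod 15) :=
    fun u => funext fun j => by rw [Subsingleton.elim j 0]; rfl
  have hc : ∀ i : Fin 2, ringHom 15 ![16, 4] (unitVec i) = fun _ => ((![16, 4] i : ℤ) : ZMod 15) :=
    fun i => ringHom_unitVec 15 ![16, 4] i
  simp only [hts, hc, ne_eq, funext_iff, Fin.forall_fin_one, Pi.add_apply]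

/-- **The CRT `t–t'` ring is the rectangular `t–t'` torus**:
`Γ (homHubbardTT' crtHom35 t t' U) Γ⁻¹ = hubbardRectTorusTT' 3 5 t t' U` along `crtEquiv35` (both hopping
graphs are carried, `relabel_hamiltonian`). [cite: EsslerEtAl2005, §2.2.1 eqs. (2.32)–(2.39)] -/
theorem relabel_crtEquiv35_homHubbardTT'_crtHom35 (t t' U : ℝ) :
    relabel (Orb.mapEquiv crtEquiv35) (homHubbardTT' crtHom35 t t' U) = hubbardRectTorusTT' 3 5 t t' U := by
  rw [homHubbardTT', homHubbard, homHubbard, relabel_add,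
    relabel_hamiltonian (homTorusGraph crtHom35) (fermionRectTorusGraph 3 5) crtEquiv35
      fermionRectTorusGraph_adj_crtEquiv35 t U,
    relabel_hamiltonian (homTorusGraph (crtHom35.comp diagMap)) (fermionRectTorusDiagGraph 3 5) crtEquiv35
      fermionRectTorusDiagGraph_adj_crtEquiv35_crtHom35 t' 0, hubbardRectTorusTT']

/-- **Sector energies of the rectangular `3 × 5` `t–t'` torus = those of the CRT ring `crtHom35`**, in
every joint sector `(N, S^z = M)` (`minEnergyOn_relabel_szSector`).
[cite: BratteliRobinsonII1997, §5.2.2, Thm. 5.2.5] -/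
theorem minEnergyOn_hubbardRectTorusTT'_szSector_eq_crtHom35 (t t' U : ℝ) (Ne : ℕ) (M : ℝ) :
    (hubbardRectTorusTT' 3 5 t t' U).minEnergyOn (szSector Ne M) =
      (homHubbardTT' crtHom35 t t' U).minEnergyOn (szSector Ne M) := by
  rw [← relabel_crtEquiv35_homHubbardTT'_crtHom35, minEnergyOn_relabel_szSector]

/-- The adjacency check behind `fermionRectTorusDiagGraph_adj_crtEquiv35_crtHom53`: on residues
`k, k' ∈ ℤ/15`, "`(k mod 3, k mod 5)` and `(k' mod 3, k' mod 5)` are DIAGONAL neighbours of the `3 × 5`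
torus" iff "`k' − k ∈ {±1, ∓4} = {±16, ∓4} mod 15`" (all `225` pairs, by `decide`). [folklore] -/
theorem crt53Diag_adj_iff : ∀ k k' : Fin 15,
    (fermionRectTorusDiagGraph 3 5).Adj (toLex (crt35Pair k)) (toLex (crt35Pair k')) ↔
      (((k : ℕ) : ZMod 15) ≠ ((k' : ℕ) : ZMod 15) ∧ ∃ i : Fin 2,
        ((k' : ℕ) : ZMod 15) = ((k : ℕ) : ZMod 15) + ((![16, -4] i : ℤ) : ZMod 15) ∨
          ((k : ℕ) : ZMod 15) = ((k' : ℕ) : ZMod 15) + ((![16, -4] i : ℤ) : ZMod 15)) := by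
  decide

/-- **The diagonal CRT graph is the diagonal graph of the `3 × 5` torus**: `crtEquiv35` carries the
Cayley graph of `ℤ/15` generated by `crtHom53 ∘ D` (signed hops `{±1, ∓4} = {±16, ∓4} mod 15`) onto
`fermionRectTorusDiagGraph 3 5`. [folklore] -/
theorem fermionRectTorusDiagGraph_adj_crtEquiv35_crtHom53 (x y : FermionTorus 1 15) :
    (fermionRectTorusDiagGraph 3 5).Adj (crtEquiv35 x) (crtEquiv35 y) ↔
      (homTorusGraph (crtHom53.comp diagMap)).Adj x y := by
  rw [crtHom53_comp_diagMap, homTorusGraph_adj, homSiteGraph_adj_iff,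
    show crtEquiv35 x = toLex (crt35Pair (ofLex x 0)) from rfl,
    show crtEquiv35 y = toLex (crt35Pair (ofLex y 0)) from rfl, crt53Diag_adj_iff]
  have hts : ∀ u : FermionTorus 1 15, u.toTorusSite = fun _ => ((ofLex u 0 : ℕ) : ZMod 15) :=
    fun u => funext fun j => by rw [Subsingleton.elim j 0]; rfl
  have hc : ∀ i : Fin 2, ringHom 15 ![16, -4] (unitVec i) = fun _ => ((![16, -4] i : ℤ) : ZMod 15) :=
    fun i => ringHom_unitVec 15 ![16, -4] i
  simp only [hts, hc, ne_eq, funext_iff, Fin.forall_fin_one, Pi.add_apply]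

/-- **The CRT `t–t'` ring is the rectangular `t–t'` torus**:
`Γ (homHubbardTT' crtHom53 t t' U) Γ⁻¹ = hubbardRectTorusTT' 3 5 t t' U` along `crtEquiv35` (both hopping
graphs are carried, `relabel_hamiltonian`). [cite: EsslerEtAl2005, §2.2.1 eqs. (2.32)–(2.39)] -/
theorem relabel_crtEquiv35_homHubbardTT'_crtHom53 (t t' U : ℝ) :
    relabel (Orb.mapEquiv crtEquiv35) (homHubbardTT' crtHom53 t t' U) = hubbardRectTorusTT' 3 5 t t' U := by
  rw [homHubbardTT', homHubbard, homHubbard, relabel_add,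
    relabel_hamiltonian (homTorusGraph crtHom53) (fermionRectTorusGraph 3 5) crtEquiv35
      fermionRectTorusGraph_adj_crtEquiv35_crtHom53 t U,
    relabel_hamiltonian (homTorusGraph (crtHom53.comp diagMap)) (fermionRectTorusDiagGraph 3 5) crtEquiv35
      fermionRectTorusDiagGraph_adj_crtEquiv35_crtHom53 t' 0, hubbardRectTorusTT']

/-- **Sector energies of the rectangular `3 × 5` `t–t'` torus = those of the CRT ring `crtHom53`**, in
every joint sector `(N, S^z = M)` (`minEnergyOn_relabel_szSector`).
[cite: BratteliRobinsonII1997, §5.2.2, Thm. 5.2.5] -/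
theorem minEnergyOn_hubbardRectTorusTT'_szSector_eq_crtHom53 (t t' U : ℝ) (Ne : ℕ) (M : ℝ) :
    (hubbardRectTorusTT' 3 5 t t' U).minEnergyOn (szSector Ne M) =
      (homHubbardTT' crtHom53 t t' U).minEnergyOn (szSector Ne M) := by
  rw [← relabel_crtEquiv35_homHubbardTT'_crtHom53, minEnergyOn_relabel_szSector]

/-- **`t–t'` window certificate ⇒ EVERY sector of the rectangular `3 × 5` PP `t–t'` torus (kernel row)**
(window of coordinate spreads `≤ 2`, `≤ 4`; every `a, b ≤ 15`; `/15`).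
[cite: Han2020Bootstrap, §3] [cite: LeBlancEtAl2015, eq. (1)] -/
theorem rect35TT'_minEnergyOn_upDownSector_div_ge_of_window_certificate (t t' U : ℝ) {nu nd : ℕ}
    (hnu : nu ≤ Fintype.card (FermionTorus 1 15)) (hnd : nd ≤ Fintype.card (FermionTorus 1 15))
    {Λ Λ' : Finset (Site 2)} (hΛ : Λ ⊆ Λ')
    (hspread : ∀ x ∈ Λ', ∀ y ∈ Λ', |x 0 - y 0| ≤ (2 : ℤ) ∧ |x 1 - y 1| ≤ (4 : ℤ))
    (h8 : thicken Λ 1 ⊆ Λ') (h0 : thicken ({0} : Finset (Site 2)) 1 ⊆ Λ') (hz : (0 : Site 2) ∈ Λ')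
    (μ : Fin 2 → ℝ) (ν : ℝ)
    {m : Type*} [Fintype m] [DecidableEq m] {Λm : Matrix m m ℂ} (hΛm : Λm.PosSemidef)
    (O : m → FermionOp Λ')
    {κ : Type*} (s : Finset κ) (B : κ → FermionOp Λ)
    {ι : Type*} (tt : Finset ι) (v : ι → Site 2) (hsh : ∀ l, shiftSet (v l) Λ ⊆ Λ') (Y : ι → FermionOp Λ)
    {γ : Type*} (u : Finset γ) (b : γ → ℂ) (cw : γ → List (Orb (PolySite Λ') × Bool))
    (hcw : ∀ j ∈ u, ladderCharge (cw j) ≠ 0 ∨ ladderSpinCharge (cw j) ≠ 0)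
    {δ : Type*} (ah : Finset δ) (dc : δ → ℝ) (V : δ → FermionOp Λ')
    {κ'' : Type*} (w : Finset κ'') (a : κ'' → ℂ) (word : κ'' → List (Orb (PolySite Λ') × Bool)) {c : ℝ}
    (hcert : fermionEmbed (PolySite.incl h0) ((hubbardTTPrimeFermionInteraction t t' U).meanEnergyObs 1) -
        (c : ℂ) • (1 : FermionOp Λ') -
        ∑ σ : Fin 2, ((μ σ : ℝ) : ℂ) • (nAt 0 hz σ - ((ν : ℝ) : ℂ) • (1 : FermionOp Λ')) =
      gramForm Λm O +
        (∑ k ∈ s, ((hubbardTTPrimeFermionInteraction t t' U).localHamiltonian Λ' * fermionEmbed (PolySite.incl hΛ) (B k) -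
            fermionEmbed (PolySite.incl hΛ) (B k) * (hubbardTTPrimeFermionInteraction t t' U).localHamiltonian Λ') +
          ∑ l ∈ tt, (fermionEmbed (PolySite.incl (hsh l)) (fermionEmbed (PolySite.shiftEmb (v l) Λ) (Y l)) -
            fermionEmbed (PolySite.incl hΛ) (Y l)) +
          ∑ j ∈ u, b j • ladderWord (cw j)) +
        (∑ m' ∈ ah, ((dc m' : ℝ) : ℂ) • ((V m')ᴴ - V m') + ∑ k ∈ w, a k • ladderWord (word k))) :
    c - ∑ k ∈ w, ‖a k‖ + (∑ σ : Fin 2, μ σ) * (((nu : ℝ) + nd) / 2 / 15 - ν) ≤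
      (hubbardRectTorusTT' 3 5 t t' U).minEnergyOn (szSector (nu + nd) (((nu : ℝ) - nd) / 2)) / 15 := by
  have hInj' : Set.InjOn crtHom35 ↑Λ' := injOn_ringHom_two_of_spread 15 ![10, 6] (M₀ := 2) (M₁ := 4)
    (fun _ _ _ _ _ _ h₅ => by simp only [Matrix.cons_val_zero, Matrix.cons_val_one] at h₅; omega) hspread
  have hd : Function.Injective (signedHop crtHom35) := injective_signedHop_ringHom 15 ![10, 6] (by decide)
  have hd' : Function.Injective (signedHop (crtHom35.comp diagMap)) := by
    rw [crtHom35_comp_diagMap]; exact injective_signedHop_ringHom 15 ![16, 4] (by decide)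
  have h := homTorusTT'_minEnergyOn_upDownSector_div_ge_of_window_certificate_avg crtHom35 t t' U hd hd' hnu hnd
    hΛ h8 h0 hz hInj' μ ν hΛm O s B tt v hsh Y u b cw hcw ah dc V w a word hcert
  simp only [Nat.cast_ofNat, pow_one] at h
  rwa [minEnergyOn_hubbardRectTorusTT'_szSector_eq_crtHom35]

/-- **The same `3 × 5` `t–t'` row for windows drawn in a `5 × 3` box** (coordinate spreads `≤ 4`, `≤ 2`;
transposed generators `crtHom53`). [cite: Han2020Bootstrap, §3] [cite: LeBlancEtAl2015, eq. (1)] -/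
theorem rect35TT'_minEnergyOn_upDownSector_div_ge_of_window_certificate_transposed (t t' U : ℝ) {nu nd : ℕ}
    (hnu : nu ≤ Fintype.card (FermionTorus 1 15)) (hnd : nd ≤ Fintype.card (FermionTorus 1 15))
    {Λ Λ' : Finset (Site 2)} (hΛ : Λ ⊆ Λ')
    (hspread : ∀ x ∈ Λ', ∀ y ∈ Λ', |x 0 - y 0| ≤ (4 : ℤ) ∧ |x 1 - y 1| ≤ (2 : ℤ))
    (h8 : thicken Λ 1 ⊆ Λ') (h0 : thicken ({0} : Finset (Site 2)) 1 ⊆ Λ') (hz : (0 : Site 2) ∈ Λ')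
    (μ : Fin 2 → ℝ) (ν : ℝ)
    {m : Type*} [Fintype m] [DecidableEq m] {Λm : Matrix m m ℂ} (hΛm : Λm.PosSemidef)
    (O : m → FermionOp Λ')
    {κ : Type*} (s : Finset κ) (B : κ → FermionOp Λ)
    {ι : Type*} (tt : Finset ι) (v : ι → Site 2) (hsh : ∀ l, shiftSet (v l) Λ ⊆ Λ') (Y : ι → FermionOp Λ)
    {γ : Type*} (u : Finset γ) (b : γ → ℂ) (cw : γ → List (Orb (PolySite Λ') × Bool))
    (hcw : ∀ j ∈ u, ladderCharge (cw j) ≠ 0 ∨ ladderSpinCharge (cw j) ≠ 0)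
    {δ : Type*} (ah : Finset δ) (dc : δ → ℝ) (V : δ → FermionOp Λ')
    {κ'' : Type*} (w : Finset κ'') (a : κ'' → ℂ) (word : κ'' → List (Orb (PolySite Λ') × Bool)) {c : ℝ}
    (hcert : fermionEmbed (PolySite.incl h0) ((hubbardTTPrimeFermionInteraction t t' U).meanEnergyObs 1) -
        (c : ℂ) • (1 : FermionOp Λ') -
        ∑ σ : Fin 2, ((μ σ : ℝ) : ℂ) • (nAt 0 hz σ - ((ν : ℝ) : ℂ) • (1 : FermionOp Λ')) =
      gramForm Λm O +
        (∑ k ∈ s, ((hubbardTTPrimeFermionInteraction t t' U).localHamiltonian Λ' * fermionEmbed (PolySite.incl hΛ) (B k) -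
            fermionEmbed (PolySite.incl hΛ) (B k) * (hubbardTTPrimeFermionInteraction t t' U).localHamiltonian Λ') +
          ∑ l ∈ tt, (fermionEmbed (PolySite.incl (hsh l)) (fermionEmbed (PolySite.shiftEmb (v l) Λ) (Y l)) -
            fermionEmbed (PolySite.incl hΛ) (Y l)) +
          ∑ j ∈ u, b j • ladderWord (cw j)) +
        (∑ m' ∈ ah, ((dc m' : ℝ) : ℂ) • ((V m')ᴴ - V m') + ∑ k ∈ w, a k • ladderWord (word k))) :
    c - ∑ k ∈ w, ‖a k‖ + (∑ σ : Fin 2, μ σ) * (((nu : ℝ) + nd) / 2 / 15 - ν) ≤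
      (hubbardRectTorusTT' 3 5 t t' U).minEnergyOn (szSector (nu + nd) (((nu : ℝ) - nd) / 2)) / 15 := by
  have hInj' : Set.InjOn crtHom53 ↑Λ' := injOn_ringHom_two_of_spread 15 ![6, 10] (M₀ := 4) (M₁ := 2)
    (fun _ _ _ _ _ _ h₅ => by simp only [Matrix.cons_val_zero, Matrix.cons_val_one] at h₅; omega) hspread
  have hd : Function.Injective (signedHop crtHom53) := injective_signedHop_ringHom 15 ![6, 10] (by decide)
  have hd' : Function.Injective (signedHop (crtHom53.comp diagMap)) := by
    rw [crtHom53_comp_diagMap]; exact injective_signedHop_ringHom 15 ![16, -4] (by decide)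
  have h := homTorusTT'_minEnergyOn_upDownSector_div_ge_of_window_certificate_avg crtHom53 t t' U hd hd' hnu hnd
    hΛ h8 h0 hz hInj' μ ν hΛm O s B tt v hsh Y u b cw hcw ah dc V w a word hcert
  simp only [Nat.cast_ofNat, pow_one] at h
  rwa [minEnergyOn_hubbardRectTorusTT'_szSector_eq_crtHom53]

end Rect35

end Summit.Ventures.CertifiedManyBodySolver.Rows

end
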